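import Literature.Probability.Percolation.DecisionTreeThreeConfig
import Mathlib.Tactic.FinCases
import HarnessLib

/-!
# `NoHeavyLowerTail` (stmt-CriticalPhenomena-4575) — k-copy switching, I: the counting form of the switching lemma and the
# certificate principle for `k` independent configurations

Support file (prover prim-masterthm-p1, MASTER THEOREM P1 = k-uniform switching schema; `--supports stmt-CriticalPhenomena-4575`).
No named facts, no sorries.

The switching certificates for Sahi's functionals `E_k` (MASTER-FAMILY.md §1; `prim-masterthm-p1/SCHEMA-K.md`) use `k`
independent copies `x 0, …, x (k-1)` of a Bernoulli configuration, finitely many law-preserving self-maps `Φ_b` of the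
`k`-tuple space ("programs") and potentials `λ₀`, `λ_b` on a finite code of a tuple (the tuple of terminal-partition types)
with `λ₀ + Σ_b λ_b ∘ Φ_b ≤ 0` pointwise and `E[λ₀] + Σ_b E[λ_b] = -E_k` exactly.  This file records, for every `k`:
* `wtKW`, `tuplesK` — weights and the finite space of `k`-tuples; `PermutesCopiesK` — coordinatewise copy-permuting maps;
* **`sum_wtKW_comp_eq_of_injOn`** — an injective coordinatewise copy-permuting self-map preserves `μ^{⊗k}` (counting form
  of [GladkovZimin2024, Lemma 4.2]: "for every pair of configurations `C₃, C₄` there is only one path in any decision tree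
  leading to [them] and the probability of this path is … `ℙ(C₃)ℙ(C₄)` since the probability in Bernoulli percolation is a
  product of probabilities for individual edges");
* **`certificate_sum_nonposK`** — the certificate principle of [GladkovZimin2024, §5], `k` copies.
It is the `Fin k` form of the tree's `Literature/Probability/Percolation/DecisionTreeThreeConfig.lean`
(`sum_wt3W_comp_eq_of_injOn`, `certificate_sum_nonpos`: the case `k = 3`), same proofs.  The companion file
`…SwitchingKSequential.lean` proves that every sequential exploration program is such a map.
-/

noncomputable section

open Classical

namespace Summit.CriticalPhenomena.PercolationContinuityZ3.Theorems

namespace SwitchingK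

open Finset Literature.Probability.Percolation Literature.Probability.Percolation.DecisionTree

variable {ι : Type*} [DecidableEq ι] {k : ℕ}

/-! ### Tuples of configurations and their weights -/

/-- The weight of a `k`-tuple of independent configurations with common coordinate probabilities `p`:
`∏_{j < k} wtW D p (x j)`. [cite: GladkovZimin2024, Lemma 4.2 (independent copies with the same law); k-copy form] -/
def wtKW (D : Finset ι) (p : ι → ℝ) (x : Fin k → Finset ι) : ℝ := ∏ j, wtW D p (x j)

/-- The finite set of `k`-tuples of configurations inside `D`. [folklore] -/
def tuplesK (D : Finset ι) (k : ℕ) : Finset (Fin k → Finset ι) := Fintype.piFinset fun _ : Fin k => D.powerset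

omit [DecidableEq ι] in
/-- Membership in `tuplesK D k`: every copy is a configuration inside `D`. [folklore] -/
theorem mem_tuplesK {D : Finset ι} {x : Fin k → Finset ι} : x ∈ tuplesK D k ↔ ∀ j, x j ⊆ D := by
  simp [tuplesK, Fintype.mem_piFinset]

/-- Tuple weights are nonnegative for `p ∈ [0, 1]`. [folklore] -/
theorem wtKW_nonneg (D : Finset ι) {p : ι → ℝ} (hp0 : ∀ i, 0 ≤ p i) (hp1 : ∀ i, p i ≤ 1)
    (x : Fin k → Finset ι) : 0 ≤ wtKW D p x := by
  unfold wtKW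
  exact prod_nonneg fun j _ => wtW_nonneg D hp0 hp1 (x j)

/-! ### The counting form of the switching lemma, `k` copies -/

/-- A self-map of `k`-tuples *permutes the copies coordinatewise* if at every coordinate the `k` output bits are a
permutation of the `k` input bits. [cite: GladkovZimin2024, Def. 4.1 and Lemma 4.2; k-copy form] -/
def PermutesCopiesK (Φ : (Fin k → Finset ι) → (Fin k → Finset ι)) : Prop :=
  ∀ x i, ∃ π : Equiv.Perm (Fin k), ∀ j, (i ∈ Φ x j ↔ i ∈ x (π j))

/-- A coordinatewise copy-permuting map preserves the weight of every tuple ("the probability in Bernoulli percolation is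
a product of probabilities for individual edges"). [cite: GladkovZimin2024, proof of Lemma 4.2; k-copy form] -/
theorem wtKW_eq_of_permutesCopiesK (p : ι → ℝ) {Φ : (Fin k → Finset ι) → (Fin k → Finset ι)}
    (hΦ : PermutesCopiesK Φ) (D : Finset ι) (x : Fin k → Finset ι) : wtKW D p (Φ x) = wtKW D p x := by
  unfold wtKW wtW
  rw [Finset.prod_comm, Finset.prod_comm (s := Finset.univ) (t := D)]
  refine prod_congr rfl fun i _ => ?_
  obtain ⟨π, hπ⟩ := hΦ x i
  calc ∏ j, (if i ∈ Φ x j then p i else 1 - p i)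
      = ∏ j, (if i ∈ x (π j) then p i else 1 - p i) := prod_congr rfl fun j _ => by simp only [hπ j]
    _ = ∏ j, (if i ∈ x j then p i else 1 - p i) := Equiv.prod_comp π (fun j => if i ∈ x j then p i else 1 - p i)

/-- **Counting form of the switching lemma, `k` copies**: a coordinatewise copy-permuting self-map of the tuples inside
`D` that is injective is a weight-preserving bijection, so the output tuple has the law of the input tuple:
`Σ_x wtKW x · f (Φ x) = Σ_x wtKW x · f x`. [cite: GladkovZimin2024, Lemma 4.2 (proof: one tree path per output
tuple, same product weight); k-copy form] -/
theorem sum_wtKW_comp_eq_of_injOn (p : ι → ℝ) {Φ : (Fin k → Finset ι) → (Fin k → Finset ι)}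
    (hΦ : PermutesCopiesK Φ) (D : Finset ι) (hmaps : ∀ x ∈ tuplesK D k, Φ x ∈ tuplesK D k)
    (hinj : Set.InjOn Φ (tuplesK D k)) (f : (Fin k → Finset ι) → ℝ) :
    ∑ x ∈ tuplesK D k, wtKW D p x * f (Φ x) = ∑ x ∈ tuplesK D k, wtKW D p x * f x := by
  have hmaps' : Set.MapsTo Φ (tuplesK D k) (tuplesK D k) := fun x hx => hmaps x hx
  have hsurj : Set.SurjOn Φ (tuplesK D k) (tuplesK D k) :=
    Finset.surjOn_of_injOn_of_card_le Φ hmaps' hinj le_rfl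
  calc ∑ x ∈ tuplesK D k, wtKW D p x * f (Φ x)
      = ∑ x ∈ tuplesK D k, wtKW D p (Φ x) * f (Φ x) :=
        sum_congr rfl fun x _ => by rw [wtKW_eq_of_permutesCopiesK p hΦ]
    _ = ∑ y ∈ tuplesK D k, wtKW D p y * f y :=
        Finset.sum_nbij Φ hmaps hinj hsurj fun x _ => rfl

/-! ### The certificate principle, `k` copies -/

/-- **Switching-certificate principle (`k` copies).**  Let `Φ b` (`b ∈ s`) be self-maps of the `k`-tuple space each
preserving the weighted sum (e.g. sequential programs, `sum_wtKW_comp_seqSplice`), `code` any function of a tuple (e.g. the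
tuple of terminal-partition types) and `lam0`, `lam b` real potentials on codes.  If POINTWISE
`lam0 (code x) + Σ_b lam b (code (Φ b x)) ≤ 0` for every tuple inside `D`, then `Σ_x wtKW x · (lam0 (code x) + Σ_b lam b (code x)) ≤ 0`:
the potentials' total `μ^{⊗k}`-expectation is nonpositive.  With `E[lam0] + Σ_b E[lam b] = -E_k` (the certificate's exact
identity) this gives `E_k ≥ 0`. [cite: GladkovZimin2024, §5 and Lemma 4.2; k-copy form] -/
theorem certificate_sum_nonposK (D : Finset ι) {p : ι → ℝ} (hp0 : ∀ i, 0 ≤ p i) (hp1 : ∀ i, p i ≤ 1)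
    {C : Type*} (code : (Fin k → Finset ι) → C) (lam0 : C → ℝ) {β : Type*} (s : Finset β)
    (Φ : β → (Fin k → Finset ι) → (Fin k → Finset ι))
    (hΦ : ∀ b ∈ s, ∀ g : (Fin k → Finset ι) → ℝ,
      ∑ x ∈ tuplesK D k, wtKW D p x * g (Φ b x) = ∑ x ∈ tuplesK D k, wtKW D p x * g x)
    (lam : β → C → ℝ)
    (hpt : ∀ x ∈ tuplesK D k, lam0 (code x) + ∑ b ∈ s, lam b (code (Φ b x)) ≤ 0) :
    ∑ x ∈ tuplesK D k, wtKW D p x * (lam0 (code x) + ∑ b ∈ s, lam b (code x)) ≤ 0 := by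
  have hswap : ∀ b ∈ s, ∑ x ∈ tuplesK D k, wtKW D p x * lam b (code (Φ b x)) =
      ∑ x ∈ tuplesK D k, wtKW D p x * lam b (code x) :=
    fun b hb => hΦ b hb (fun x => lam b (code x))
  have hrew : ∑ x ∈ tuplesK D k, wtKW D p x * (lam0 (code x) + ∑ b ∈ s, lam b (code x)) =
      ∑ x ∈ tuplesK D k, wtKW D p x * (lam0 (code x) + ∑ b ∈ s, lam b (code (Φ b x))) := by
    simp only [mul_add, sum_add_distrib, mul_sum]
    congr 1
    rw [sum_comm, sum_comm (s := tuplesK D k)]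
    exact sum_congr rfl fun b hb => (hswap b hb).symm
  rw [hrew]
  exact sum_nonpos fun x hx => mul_nonpos_of_nonneg_of_nonpos (wtKW_nonneg D hp0 hp1 x) (hpt x hx)

end SwitchingK

end Summit.CriticalPhenomena.PercolationContinuityZ3.Theorems

end
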